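import Summits.CriticalPhenomena.PercolationContinuityZ3.Theorems.PercNearOneGluingNoHeavyQuantNearRouteShape
import Summits.CriticalPhenomena.PercolationContinuityZ3.Theorems.PercNearOneGluingNoHeavyQuantSubfloorPairHub
import HarnessLib

/-!
# QUANT lane R8, T-DEC: THE COST-SAFE ROUTE CERTIFICATE — one (possibly FAR) cost-safe route per charged low atom ⟹ SDEC (census-1 gen 35)

builds on p205010 (kernel theorem, internal audit signed; external expert review pending)

Support file (`--supports stmt-CriticalPhenomena-4575`), QUANT lane seat prim-quant-census-1 (gen 35); memo
`run/shared/lean/prim/quant/prim-quant-census-1/g35/QUADHUB-G35.md` §4.  Theorems only (no definitions), standard axioms, no sorries.  Generalises g31's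
`sdec_of_nearRoutes_charged` (`…QuantNearRouteShape`: every target `h < T`, i.e. NEAR routes) to COST-SAFE routes in the sense of arm-1 g50's
`flowAtT_of_safeTransport` (`…QuantTorqueCost`): the target `h = t T l` of the charged positive low `l` may exceed the gated mean `T` provided
`y·(h − l) ≤ T − l` at the gated floor `y = a·x = x·T/T₀` — then its torque cost is at most its budget term and no cost bookkeeping is needed.  This is
exactly the shape of the width-4 / width-5 long-tail hub proofs of this generation (`…QuantLongTailQuadHub`, `…QuintHub`: reflected routes
`4lo → 4lo+2K`, `4lo → 4lo+3K`, `5lo → 5lo+4K` are far but cost-safe), packaged once for every width: the uniform rule `t(s) = min(⌊D/K⌋+2, j−1) − s` of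
memo §1 (0 exceptions through width 8, kit j309528) is a route map in the sense below, so the every-width long-tail hub theorem reduces to its two
capacity inequalities per route (memo §4 (2)).
* **`sdec_of_safeRoutes_charged`** — `μ` a probability law on `{0..M}` with mean `T₀ > 0`, floor `0 < x < 1`, `x·M ≤ T₀`; a route map `t` such that
  for every target `0 < T ≤ T₀` and every charged positive low `l` (`1 ≤ l`, `2l < T`, `μ l > 0`) the absorber `h = t T l` satisfies `l < h ≤ M`,
  `T < l + h`, the COST-SAFETY `(x·T/T₀)·(h − l) ≤ T − l` and the capacity `max(x·T/T₀, (T−2l)/(h−l))·(μ l + μ h) ≤ μ h` (the floor part at the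
  gated floor `x·T/T₀`, sharper than `x`), and `t T` is injective on the charged positive lows of `T`.  Then `SDEC x M μ`.
* **`sdec_of_safeRoutes_charged'`** — the same with the capacity stated at the ungated floor `x` (as in `sdec_of_nearRoutes_charged`).

HONEST STATUS.  Certificate infrastructure; `SiblingStep`, `GluedDominatedMass`, `SDECConvClosed`, `FarTreeRow` OPEN; RATE class (log\*) / honest
sentence of `run/shared/lean/prim/quant/README.md` unchanged.  [this work].  Nothing here is cited as a published result.  The gluing rows served
[cite: KozmaNitzan2024, Conjecture 3 (p. 15)]; product measure [cite: Grimmett1999, §1.3 p. 10].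
-/

noncomputable section

open scoped BigOperators

namespace Summit.CriticalPhenomena.PercolationContinuityZ3.Theorems
namespace Quant
namespace LawDec

open Finset

/-! ### One cost-safe route per charged low atom -/

/-- **ONE COST-SAFE ROUTE PER CHARGED LOW ATOM ⟹ SDEC.**  `μ` a probability law on `{0..M}` with mean `T₀ > 0`, floor `0 < x < 1`, `x·M ≤ T₀`; a route
map `t` such that for every target `0 < T ≤ T₀` and every charged positive low `l` (`1 ≤ l`, `2l < T`, `0 < μ l`) the absorber `h = t T l` satisfies
`l < h`, `h ≤ M`, `T < l + h`, `(x·T/T₀)·(h − l) ≤ T − l` (cost-safe at the gated floor) and `max(x·T/T₀, (T−2l)/(h−l))·(μ l + μ h) ≤ μ h`, with `t T`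
injective on the charged positive lows of `T`.  Then `SDEC x M μ` (at the outer gate `a = T/T₀` every charged low ships whole to its absorber;
`flowAtT_of_safeTransport`). [this work] -/
theorem sdec_of_safeRoutes_charged (x T₀ : ℝ) (M : ℕ) (μ : ℕ → ℝ) (t : ℝ → ℕ → ℕ) (hx0 : 0 < x) (hx1 : x < 1)
    (hμ0 : ∀ h, 0 ≤ μ h) (hμM : ∀ h, M < h → μ h = 0) (hμ1 : ∑ h ∈ Finset.range (M + 1), μ h = 1)
    (hT : ∑ h ∈ Finset.range (M + 1), (h : ℝ) * μ h = T₀) (hT0 : 0 < T₀) (hta : x * (M : ℝ) ≤ T₀)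
    (hroute : ∀ T : ℝ, 0 < T → T ≤ T₀ → ∀ l : ℕ, 1 ≤ l → 2 * (l : ℝ) < T → 0 < μ l →
      l < t T l ∧ t T l ≤ M ∧ T < (l : ℝ) + (t T l : ℕ) ∧ (x * T / T₀) * (((t T l : ℕ) : ℝ) - l) ≤ T - l ∧
      max (x * T / T₀) ((T - 2 * (l : ℝ)) / (((t T l : ℕ) : ℝ) - l)) * (μ l + μ (t T l)) ≤ μ (t T l))
    (hinj : ∀ T : ℝ, 0 < T → T ≤ T₀ → ∀ l l' : ℕ, 1 ≤ l → 2 * (l : ℝ) < T → 0 < μ l → 1 ≤ l' → 2 * (l' : ℝ) < T → 0 < μ l' →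
      t T l = t T l' → l = l') :
    SDEC x M μ := by
  classical
  intro a ha0 ha1 j' hj'
  obtain ⟨g0, gM, g1⟩ := gate_laws M μ a ha0.le ha1 hμ0 hμM hμ1
  have gmean : ∑ h ∈ Finset.range (M + 1), (h : ℝ) * gate μ a h = a * T₀ := by rw [sum_mul_gate, hT]
  have gpos : ∀ h : ℕ, h ≠ 0 → gate μ a h = a * μ h := fun h hh => by
    rw [gate_apply, if_neg hh, mul_zero, add_zero]
  set T : ℝ := a * T₀ with hTdef
  set y : ℝ := a * x with hydef
  have hy0 : 0 < y := mul_pos ha0 hx0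
  have hyx : y ≤ x := by
    have := mul_le_mul_of_nonneg_right ha1 hx0.le
    rwa [one_mul] at this
  have hy1 : y < 1 := lt_of_le_of_lt hyx hx1
  have hTpos : 0 < T := mul_pos ha0 hT0
  have hTle : T ≤ T₀ := by
    have := mul_le_mul_of_nonneg_right ha1 hT0.le
    rwa [one_mul] at this
  have hta' : y * (M : ℝ) ≤ T := by
    have := mul_le_mul_of_nonneg_left hta ha0.le
    rw [hydef, hTdef, mul_assoc]; exact this
  -- the gated floor `x·T/T₀` IS `y = a·x`
  have eyT : x * T / T₀ = y := by rw [hTdef, hydef]; field_simp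
  rw [decAt_iff_decAtT, gmean]
  refine decAtT_of_flowAtT y T j' M (gate μ a) hy0 hy1 gM g1 ?_
  refine flowAtT_of_safeTransport y T j' M (gate μ a)
    (fun l h => if (1 ≤ l ∧ 2 * (l : ℝ) < T ∧ h = t T l) then gate μ a l else 0)
    hy0 hy1 hTpos hj' g0 gM hta' (by rw [g1, gmean, mul_one]) ?_ ?_ ?_ ?_
  · intro l h
    show (0:ℝ) ≤ (if (1 ≤ l ∧ 2 * (l : ℝ) < T ∧ h = t T l) then gate μ a l else 0)
    split_ifs
    · exact g0 l
    · exact le_rfl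
  · intro l h hp
    change (0:ℝ) < (if (1 ≤ l ∧ 2 * (l : ℝ) < T ∧ h = t T l) then gate μ a l else 0) at hp
    split_ifs at hp with hc
    · obtain ⟨hl1, hlT, rfl⟩ := hc
      have hl0 : l ≠ 0 := by omega
      rw [gpos l hl0] at hp
      have hμl : 0 < μ l := pos_of_mul_pos_right hp ha0.le
      obtain ⟨hlt, htM, hTlt, hsafe, _⟩ := hroute T hTpos hTle l hl1 hlT hμl
      rw [eyT] at hsafe
      exact ⟨hl1, hlT, hlt, htM, hTlt, hsafe⟩
    · exact absurd hp (lt_irrefl _)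
  · intro l hl1 hlT
    have hl0 : l ≠ 0 := by omega
    have e : ∀ h, (if (1 ≤ l ∧ 2 * (l : ℝ) < T ∧ h = t T l) then gate μ a l else 0)
        = (if h = t T l then gate μ a l else 0) := fun h => by simp only [hl1, hlT, true_and]
    simp_rw [e]
    rw [Finset.sum_ite_eq']
    rcases (hμ0 l).eq_or_lt with hz | hpos
    · rw [gpos l hl0, ← hz, mul_zero]; split_ifs <;> rfl
    · obtain ⟨_, htM, _, _, _⟩ := hroute T hTpos hTle l hl1 hlT hpos
      rw [if_pos (Finset.mem_range.2 (Nat.lt_succ_of_le htM))]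
  · intro h hhM
    by_cases hex : ∃ l : ℕ, 1 ≤ l ∧ 2 * (l : ℝ) < T ∧ h = t T l ∧ 0 < μ l
    · obtain ⟨l₀, hl1, hlT, rfl, hμl⟩ := hex
      obtain ⟨hlt, _, hTlt, _, hcap⟩ := hroute T hTpos hTle l₀ hl1 hlT hμl
      rw [eyT] at hcap
      have hl₀M : l₀ ∈ Finset.range (M + 1) := Finset.mem_range.2 (by omega)
      rw [Finset.sum_eq_single_of_mem l₀ hl₀M]
      · simp only [hl1, hlT, true_and, if_true]
        have hd : (0 : ℝ) < ((t T l₀ : ℕ) : ℝ) - l₀ := by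
          have : (l₀ : ℝ) < (t T l₀ : ℕ) := by exact_mod_cast hlt
          linarith
        set ρ : ℝ := (T - 2 * (l₀ : ℝ)) / (((t T l₀ : ℕ) : ℝ) - l₀) with hρ
        have hρ1 : ρ < 1 := by rw [hρ, div_lt_one hd]; linarith
        have hθ1 : max y ρ < 1 := max_lt hy1 hρ1
        have ht0 : t T l₀ ≠ 0 := by omega
        have h2 : max y ρ * (gate μ a l₀ + gate μ a (t T l₀)) ≤ gate μ a (t T l₀) := by
          rw [gpos l₀ (by omega), gpos _ ht0]
          have := mul_le_mul_of_nonneg_left hcap ha0.le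
          have e : max y ρ * (a * μ l₀ + a * μ (t T l₀)) = a * (max y ρ * (μ l₀ + μ (t T l₀))) := by ring
          rw [e]; exact this
        unfold freeRate
        exact rate_mul_le_of_theta hθ1 h2 (g0 _)
      · intro l hl hne
        split_ifs with hc
        · have hl0 : l ≠ 0 := by omega
          rcases (hμ0 l).eq_or_lt with hzl | hpos
          · rw [gpos l hl0, ← hzl, mul_zero, mul_zero]
          · exfalso
            exact hne (hinj T hTpos hTle l l₀ hc.1 hc.2.1 hpos hl1 hlT hμl hc.2.2.symm)
        · rw [mul_zero]
    · have hz : ∀ l ∈ Finset.range (M + 1),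
          freeRate y T l h * (if (1 ≤ l ∧ 2 * (l : ℝ) < T ∧ h = t T l) then gate μ a l else 0) = 0 := by
        intro l _
        split_ifs with hc
        · have hl0 : l ≠ 0 := by omega
          rcases (hμ0 l).eq_or_lt with hzl | hpos
          · rw [gpos l hl0, ← hzl, mul_zero, mul_zero]
          · exact absurd ⟨l, hc.1, hc.2.1, hc.2.2, hpos⟩ hex
        · rw [mul_zero]
      rw [Finset.sum_congr rfl hz, Finset.sum_const_zero]
      exact g0 h

/-- **ONE COST-SAFE ROUTE PER CHARGED LOW ATOM ⟹ SDEC, floor part at the ungated floor `x`** (the form of `sdec_of_nearRoutes_charged` with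
`h < T` replaced by `h ≤ M` and cost-safety `x·(h − l) ≤ T − l`; weaker but `a`-free). [this work] -/
theorem sdec_of_safeRoutes_charged' (x T₀ : ℝ) (M : ℕ) (μ : ℕ → ℝ) (t : ℝ → ℕ → ℕ) (hx0 : 0 < x) (hx1 : x < 1)
    (hμ0 : ∀ h, 0 ≤ μ h) (hμM : ∀ h, M < h → μ h = 0) (hμ1 : ∑ h ∈ Finset.range (M + 1), μ h = 1)
    (hT : ∑ h ∈ Finset.range (M + 1), (h : ℝ) * μ h = T₀) (hT0 : 0 < T₀) (hta : x * (M : ℝ) ≤ T₀)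
    (hroute : ∀ T : ℝ, 0 < T → T ≤ T₀ → ∀ l : ℕ, 1 ≤ l → 2 * (l : ℝ) < T → 0 < μ l →
      l < t T l ∧ t T l ≤ M ∧ T < (l : ℝ) + (t T l : ℕ) ∧ x * (((t T l : ℕ) : ℝ) - l) ≤ T - l ∧
      max x ((T - 2 * (l : ℝ)) / (((t T l : ℕ) : ℝ) - l)) * (μ l + μ (t T l)) ≤ μ (t T l))
    (hinj : ∀ T : ℝ, 0 < T → T ≤ T₀ → ∀ l l' : ℕ, 1 ≤ l → 2 * (l : ℝ) < T → 0 < μ l → 1 ≤ l' → 2 * (l' : ℝ) < T → 0 < μ l' →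
      t T l = t T l' → l = l') :
    SDEC x M μ := by
  refine sdec_of_safeRoutes_charged x T₀ M μ t hx0 hx1 hμ0 hμM hμ1 hT hT0 hta (fun T hT0' hTle l hl1 hlT hμl => ?_) hinj
  obtain ⟨hlt, htM, hTlt, hsafe, hcap⟩ := hroute T hT0' hTle l hl1 hlT hμl
  have hxT : x * T / T₀ ≤ x := by
    rw [div_le_iff₀ hT0]; exact mul_le_mul_of_nonneg_left hTle hx0.le
  have hxT0 : 0 ≤ x * T / T₀ := div_nonneg (mul_nonneg hx0.le hT0'.le) hT0.le
  have hd : (0 : ℝ) ≤ ((t T l : ℕ) : ℝ) - l := by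
    have : (l : ℝ) ≤ (t T l : ℕ) := by exact_mod_cast hlt.le
    linarith
  refine ⟨hlt, htM, hTlt, (mul_le_mul_of_nonneg_right hxT hd).trans hsafe, ?_⟩
  exact (mul_le_mul_of_nonneg_right (max_le_max hxT le_rfl) (add_nonneg (hμ0 _) (hμ0 _))).trans hcap

end LawDec
end Quant
end Summit.CriticalPhenomena.PercolationContinuityZ3.Theorems
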